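import Literature.Probability.RandomPlanarGeometry.LoewnerThrClock
import Literature.Probability.RandomPlanarGeometry.StarHullSubStep
import HarnessLib

/-!
# The through-swallow image flow: definitions

Topic `Probability/RandomPlanarGeometry`; two definitions + unfolding lemmas (crux
`stmt-CriticalPhenomena-0698`, stub `stub_isLocal`, through-swallow image chain of the locality of
SLE₆: G. F. Lawler (2005), §6.3 Thm. 6.13, `Φ_t = g*_t ∘ Φ ∘ g_t⁻¹` followed through the instants at
which the hull swallows whole pieces of `A`; Lawler–Schramm–Werner (2003), §5, `g̃_t = h_t ∘ g_t ∘ Φ_A⁻¹`).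
Companion of `LoewnerRemainingHull.lean` (remaining hull `A_t^rem = remHull W A t`, slid hull
`B_t = thrSlidHull W A t`, driving function `U*_t = thrImageDriver W A t`, clock `thrClock`):

* `Loewner.thrImageFlow W A t z = g̃_t(Φ_A z) := E_{B_t}(g_t z − W_t) − L_{B_t} + W_t + L_A`, i.e. the
  ALIVE image flow `imageFlow W (A_t^rem) t z` of the remaining hull plus the constant
  `L_A − L_{A_t^rem}` (`thrImageFlow_eq_of_remHull_eq`), with `g̃_t(ζ) − U*_t = E_{B_t}(g_t z − W_t)`
  (`thrImageFlow_sub_thrImageDriver`) and `g̃_0 = E_A` (`thrImageFlow_zero`);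
* `Loewner.thrImageFlowC W A β z q = g̃_{τ q}(ζ)` — the flow in capacity time (`τ = thrClockInv W A β`).
-/

noncomputable section

open Set Filter Topology Function Complex Metric
open scoped NNReal

namespace Literature.Probability.RandomPlanarGeometry

namespace Loewner

variable {W : ℝ≥0 → ℝ} {A : Set ℂ}

/-- **The through-swallow image flow** `g̃_t(Φ_A z) = E_{B_t}(g_t z − W_t) − L_{B_t} + W_t + L_A`,
`B_t = g_t(A_t^rem) − W_t`: the alive image flow of the remaining hull plus `L_A − L_{A_t^rem}`.
[cite: Lawler2005, §6.3 Thm. 6.13 (Φ_t = g*_t ∘ Φ ∘ g_t⁻¹)] -/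
def thrImageFlow (W : ℝ≥0 → ℝ) (A : Set ℂ) (t : ℝ≥0) (z : ℂ) : ℂ :=
  imageFlow W (remHull W A t) t z - starShift (remHull W A t) + starShift A

/-- **The through-swallow image flow in capacity time** `q ↦ g̃_{τ q}(ζ)`, `τ = thrClockInv W A β`.
[cite: Lawler2005, §6.3 Thm. 6.13 with Prop. 4.41] -/
def thrImageFlowC (W : ℝ≥0 → ℝ) (A : Set ℂ) (β : ℝ≥0) (z : ℂ) (q : ℝ) : ℂ :=
  thrImageFlow W A (thrClockInv W A β q).toNNReal z

/-- Unfolding of the flow in capacity time. [folklore] -/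
theorem thrImageFlowC_apply (W : ℝ≥0 → ℝ) (A : Set ℂ) (β : ℝ≥0) (z : ℂ) (q : ℝ) :
    thrImageFlowC W A β z q = thrImageFlow W A (thrClockInv W A β q).toNNReal z := rfl

/-- **Piecewise structure of the flow**: if the remaining hull is the same at `t` and `t'`, then at `t`
the through-swallow flow is the alive image flow of the fixed hull `remHull W A t'` plus
`L_A − L_{A^rem}`. [folklore] -/
theorem thrImageFlow_eq_of_remHull_eq {t t' : ℝ≥0} (h : remHull W A t = remHull W A t') (z : ℂ) :
    thrImageFlow W A t z = imageFlow W (remHull W A t') t z - starShift (remHull W A t') + starShift A := by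
  rw [thrImageFlow, h]

/-- At an alive time the through-swallow flow is the alive image flow. [folklore] -/
theorem thrImageFlow_of_disjoint {t : ℝ≥0} (h : Disjoint (closedHull W t) A) (z : ℂ) :
    thrImageFlow W A t z = imageFlow W A t z := by
  rw [thrImageFlow, remHull_of_disjoint h, sub_add_cancel]

/-- **`g̃_t(ζ) − U*_t = E_{B_t}(g_t z − W_t)`.** [cite: LawlerSchrammWerner2003Restriction, §5 (h_t = g_{A_t})] -/
theorem thrImageFlow_sub_thrImageDriver (t : ℝ≥0) (z : ℂ) :
    thrImageFlow W A t z - thrImageDriver W A t = starMap (thrSlidHull W A t) (map W t z - W t) := by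
  rw [thrImageFlow, thrImageDriver, thrSlidHull, imageFlow]
  push_cast
  rw [← starShift_eq_ofReal, ← starShift_eq_ofReal]
  ring

/-- The flow written with the driving function: `g̃_t(ζ) = E_{B_t}(g_t z − W_t) + U*_t`. [folklore] -/
theorem thrImageFlow_eq_starMap_add (t : ℝ≥0) (z : ℂ) :
    thrImageFlow W A t z = starMap (thrSlidHull W A t) (map W t z - W t) + thrImageDriver W A t := by
  rw [← thrImageFlow_sub_thrImageDriver, sub_add_cancel]

/-- **`g̃_0 = E_A` off the driving point** (`W 0 = 0`). [folklore] -/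
theorem thrImageFlow_zero (hW : Continuous W) (hW0 : W 0 = 0) (hA : IsStarHull A) {z : ℂ} (hz : z ≠ 0) :
    thrImageFlow W A 0 z = starMap A z := by
  rw [thrImageFlow_of_disjoint (disjoint_closedHull_zero_of_isStarHull hW hW0 hA), imageFlow_zero hW hW0 hA hz]

/-- `U*_0 = 0` (`W 0 = 0`). [folklore] -/
theorem thrImageDriver_zero (hW : Continuous W) (hW0 : W 0 = 0) (hA : IsStarHull A) :
    thrImageDriver W A 0 = 0 := by
  rw [thrImageDriver_of_disjoint (disjoint_closedHull_zero_of_isStarHull hW hW0 hA), imageDriver_zero hW hW0 hA]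

/-- The flow in capacity time starts at `g̃_0(ζ)` (the clock rate being integrable on `[0, β]`).
[folklore] -/
theorem thrImageFlowC_zero {β : ℝ≥0} (hint : MeasureTheory.IntegrableOn (thrClockRate W A) (Icc (0 : ℝ) β))
    (z : ℂ) : thrImageFlowC W A β z 0 = thrImageFlow W A 0 z := by
  rw [thrImageFlowC, thrClockInv_zero hint, Real.toNNReal_zero]

/-- On `[0, σβ]` the clamp is inactive: `thrImageDriverC q⁺ = U*_{τ q}`. [folklore] -/
theorem thrImageDriverC_toNNReal {β : ℝ≥0} {q : ℝ} (hq : q ∈ Icc (0 : ℝ) (thrClock W A β)) :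
    thrImageDriverC W A β q.toNNReal = thrImageDriver W A (thrClockInv W A β q).toNNReal := by
  rw [thrImageDriverC, Real.coe_toNNReal q hq.1, min_eq_left hq.2]

end Loewner

end Literature.Probability.RandomPlanarGeometry

end
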